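import Mathlib
import Literature.NumberTheory.Sieve.QuadraticRootsPrimeModuliDFISieveEstimates

/-!
# Zhang (2022) §3, Lemma 3.6: the coefficient sum `∑ ς(n)²/n` WITHOUT the eighth-power route

Trunk T-ANT (NumberTheory/LFunctions). Y. Zhang, *Discrete mean estimates and the Landau–Siegel
zero*, arXiv:2211.02515v1 (2022) [Zhang2022LandauSiegel], §3 [p. 7 of the source]. With
`ν = 1 ∗ χ`, `υ = μ ∗ μχ` (so `∑ ν(n)n⁻ˢ = ζ(s)L(s,χ)`, `∑ υ(n)n⁻ˢ = (ζ(s)L(s,χ))⁻¹`, `ν ∗ υ = δ`)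
the source puts

> `ς(n) = ∑_{n = lm, l ≤ D⁴, m ≤ D⁴} ν(l)υ(m)`, "`ς(n) = 0` unless `n = 1` or `D⁴ < n ≤ D⁸`",
> "`|ς(n)| ≤ ∑_{n = lm} ν(l)|υ(m)| ≤ ν(n)τ₂(n)`", and concludes Lemma 3.6 "by Cauchy's inequality, the
> first assertion of Lemma 3.2 and Lemma 3.1", Lemma 3.2 being
> `∑_{D⁴ < n ≤ D⁸} ν(n)²τ₂(n)²/n ≪ 𝓛⁻²⁰⁰⁷` (proof sketched via `ζ(s)⁻⁸L(s,χ)⁻⁸ ∑ ν(n)²τ₂(n)²n⁻ˢ`).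

What Lemma 3.6 consumes is `E := ∑_{D⁴ < n ≤ D⁸} ς(n)²/n` (through Lemma 3.3 (i)); the source bounds
`E` by the `ν²τ₂²`-moment through the pointwise majorant `|ς| ≤ ντ₂`, whose generating function has
EIGHT `L`-factors — which is where the sketched proof of Lemma 3.2 needs a subconvex bound for
`L(s,χ)` (conductor `D⁸` against the cut `D⁴`; recorded by the Landau–Siegel autopsy cell as flag F7).

**Status of the source: an unrefereed manuscript, a claimed result under adjudication.** This file
PROVES, in general form and with explicit constants, the ELEMENTARY alternative reduction of the
autopsy's ALT-1 report (variant A11, `pub-zhang/b2b-zhang-alt-1/ALT-1.md` §4): for any real `f, g`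
and any level `Y` (in the source `f = ν`, `g = υ`, `Y = D⁴`),

* `sum_divisorsAntidiagonal_eq_sigmaTrunc_add`: for `n ≤ Y²` the divisor pairs `(l, m)` of `n`
  split DISJOINTLY into `{l ≤ Y, m ≤ Y} ⊔ {l > Y} ⊔ {m > Y}`, so
  `(f ∗ g)(n) = ς_Y(n) + S₁(n) + S₂(n)` with `S₁(n) = ∑_{lm = n, l > Y} f(l)g(m)`,
  `S₂(n) = ∑_{lm = n, m > Y} f(l)g(m)`; hence (`sigmaTrunc_eq_neg_of_conv_eq_zero`)
  `ς_Y(n) = −S₁(n) − S₂(n)` whenever `(f ∗ g)(n) = 0` — display (1) of ALT-1 §4;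
* `tailFst_sq_le`: Cauchy, `S₁(n)² ≤ τ(n) ∑_{lm = n, l > Y} f(l)²g(m)²`;
* `sum_tailFst_sq_div_le`: with `τ(lm) ≤ τ(l)τ(m)` and the rearrangement of `∑_{Y < n ≤ Y²} ∑_{lm = n}`
  into a sum over pairs, `∑_{Y < n ≤ Y²} S₁(n)²/n ≤ (∑_{Y < l ≤ Y²} τ(l)f(l)²/l)(∑_{m ≤ Y} τ(m)g(m)²/m)`,
  and symmetrically for `S₂` (`sum_tailSnd_sq_div_le`) — display (2) of ALT-1 §4;
* `sum_sigmaTrunc_sq_div_le`: if `(f ∗ g)(n) = 0` for `Y < n ≤ Y²` then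
  `∑_{Y < n ≤ Y²} ς_Y(n)²/n ≤ 2·V_f·U_g + 2·V_g·U_f`, `V_h = ∑_{Y < n ≤ Y²} τ(n)h(n)²/n`,
  `U_h = ∑_{n ≤ Y} τ(n)h(n)²/n`;
* `sum_sigmaTrunc_sq_div_le_of_abs_le`: if moreover `|g| ≤ f ≤ τ` pointwise then
  `E ≤ 4 · (∑_{Y < n ≤ Y²} τ(n)f(n)²/n) · ∑_{n ≤ Y} τ(n)³/n`;
* the source's instance (section `SourceInstance`, `χ` any real completely multiplicative
  arithmetic function with `χ(1) = 1`, e.g. a real Dirichlet character on `ℕ`): `nuOf χ = ζ ∗ χ`,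
  `upsilonOf χ = μ ∗ μχ`, `nuOf_mul_upsilonOf : ν ∗ υ = δ` (so the vanishing hypothesis holds for
  `Y < n ≤ Y²`, `Y ≥ 1`), `abs_upsilonOf_le_nuOf : |υ| ≤ ν` when `|χ| ≤ 1` (from the prime-power
  values `υ(p) = −1 − χ(p)`, `υ(p²) = χ(p)`, `υ(pᵏ) = 0` for `k ≥ 3`, `ν(pᵏ) = ∑_{i ≤ k} χ(p)ⁱ`),
  `nuOf_le_card_divisors : ν ≤ τ`, and the two instantiated bounds `sum_sigma_sq_div_le_source`
  (`E ≤ 2·V_ν·U_υ + 2·V_υ·U_ν`) and `sum_sigma_sq_div_le_source_tau_cubed`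
  (`E ≤ 4·V_ν·∑_{n ≤ Y} τ(n)³/n`).
* the divisor factor in closed form (section `DivisorFactor`): by iterated Cauchy products
  `sum_card_divisors_pow_succ_div_le_sq` (`∑_{n ≤ Y} τ^{j+1}/n ≤ (∑_{n ≤ Y} τ^j/n)²`) and the
  harmonic bound, `sum_card_divisors_pow_div_le_log_pow` (`∑_{n ≤ Y} τ(n)^j/n ≤ (1 + log Y)^{2^j}`),
  in particular `sum_card_divisors_cube_div_le_log_pow` (`∑_{n ≤ Y} τ(n)³/n ≤ (1 + log Y)⁸`); whence
  `sum_sigmaTrunc_sq_div_le_log_pow` / `sum_sigma_sq_div_le_source_log_pow`: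
  `E ≤ 4 (1 + log Y)⁸ · V_f` (resp. `· V_ν`) — the elementary part of the reduction with every
  constant explicit.

Consequence recorded by the cell (not formalised here, it is analytic): the generating function of
`ν²τ₂` is `ζ(s)⁴L(s,χ)⁴·H(s)` with `H` absolutely convergent for `σ > 1/2`, i.e. FOUR `L`-factors
(analytic conductor `≍ D⁴` in the `D`-aspect) against a sum starting at the cut `D⁴`: a contour shift
in the style of the source's Lemma 3.1 then closes with the convexity bound alone and gives
`∑_{D⁴ < n ≤ D⁸} ν²τ₂/n ≪ 𝓛⁻²⁰¹⁵` under the source's hypothesis (A); with `∑_{n ≤ D⁴} τ³/n ≍ 𝓛⁸`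
(here PROVED in the form `≤ (1 + 4 log D)⁸`) this recovers `E ≪ 𝓛⁻²⁰⁰⁷`, the printed exponent
of Lemma 3.2, with no subconvexity input (ALT-1.md §4, variant A11). This is VERDICT-NEUTRAL for
the autopsy: the located gap of the source is at (8.24), downstream of §3 and independent of every
analytic input. No statement about Theorems 1–2 of the source is made or implied.
-/

namespace Literature.NumberTheory.LFunctions.Zhang2022

open Finset

/-! ### The three pieces of a Dirichlet convolution at level `Y` -/

/-- The source's truncated convolution `ς(n) = ∑_{n = lm, l ≤ Y, m ≤ Y} f(l)g(m)` (`Y = D⁴`,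
`f = ν`, `g = υ`). [cite: Zhang2022LandauSiegel, §3 before Lemma 3.6] -/
noncomputable def sigmaTrunc (f g : ℕ → ℝ) (Y n : ℕ) : ℝ :=
  ∑ x ∈ n.divisorsAntidiagonal with x.1 ≤ Y ∧ x.2 ≤ Y, f x.1 * g x.2

/-- `S₁(n) = ∑_{lm = n, l > Y} f(l)g(m)`, the part of `(f ∗ g)(n)` with first variable beyond the
cut. [folklore] -/
noncomputable def tailFst (f g : ℕ → ℝ) (Y n : ℕ) : ℝ :=
  ∑ x ∈ n.divisorsAntidiagonal with Y < x.1, f x.1 * g x.2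

/-- `S₂(n) = ∑_{lm = n, m > Y} f(l)g(m)`, the part of `(f ∗ g)(n)` with second variable beyond the
cut. [folklore] -/
noncomputable def tailSnd (f g : ℕ → ℝ) (Y n : ℕ) : ℝ :=
  ∑ x ∈ n.divisorsAntidiagonal with Y < x.2, f x.1 * g x.2

/-! ### Display (1): the splitting identity -/

/-- For `n ≤ Y²` the divisor pairs of `n` split disjointly into `{l ≤ Y ∧ m ≤ Y}`, `{Y < l}`,
`{Y < m}` (both `l, m > Y` would force `lm > Y²`): `(f ∗ g)(n) = ς_Y(n) + S₁(n) + S₂(n)`.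
[folklore] -/
theorem sum_divisorsAntidiagonal_eq_sigmaTrunc_add (f g : ℕ → ℝ) {Y n : ℕ} (hn : n ≤ Y * Y) :
    ∑ x ∈ n.divisorsAntidiagonal, f x.1 * g x.2 =
      sigmaTrunc f g Y n + tailFst f g Y n + tailSnd f g Y n := by
  classical
  unfold sigmaTrunc tailFst tailSnd
  rw [← sum_filter_add_sum_filter_not n.divisorsAntidiagonal (fun x => x.1 ≤ Y ∧ x.2 ≤ Y),
    add_assoc]
  congr 1
  rw [← sum_filter_add_sum_filter_not
      (n.divisorsAntidiagonal.filter fun x => ¬(x.1 ≤ Y ∧ x.2 ≤ Y)) (fun x => Y < x.1),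
    filter_filter, filter_filter]
  congr 1
  · refine sum_congr (filter_congr fun x _ => ?_) fun _ _ => rfl
    constructor
    · exact fun h => h.2
    · exact fun h => ⟨fun h' => absurd h'.1 (not_le.mpr h), h⟩
  · refine sum_congr (filter_congr fun x hx => ?_) fun _ _ => rfl
    rw [Nat.mem_divisorsAntidiagonal] at hx
    constructor
    · rintro ⟨h1, h2⟩
      rw [not_lt] at h2
      by_contra h3
      exact h1 ⟨h2, not_lt.mp h3⟩
    · intro h
      refine ⟨fun h' => absurd h'.2 (not_le.mpr h), fun h1 => ?_⟩
      have hlt : Y * Y < x.1 * x.2 := Nat.mul_lt_mul'' h1 h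
      rw [hx.1] at hlt
      exact absurd (hlt.trans_le hn) (lt_irrefl _)

/-- **Display (1) of ALT-1 §4** (the source's "`ς(n) = 0` unless …" mechanism made quantitative):
if `(f ∗ g)(n) = 0` and `n ≤ Y²` then `ς_Y(n) = −S₁(n) − S₂(n)`. In the source `ν ∗ υ = δ`, so this
holds for every `1 < n ≤ D⁸`. [cite: Zhang2022LandauSiegel, §3] -/
theorem sigmaTrunc_eq_neg_of_conv_eq_zero (f g : ℕ → ℝ) {Y n : ℕ} (hn : n ≤ Y * Y)
    (hconv : ∑ x ∈ n.divisorsAntidiagonal, f x.1 * g x.2 = 0) :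
    sigmaTrunc f g Y n = -tailFst f g Y n - tailSnd f g Y n := by
  have h := sum_divisorsAntidiagonal_eq_sigmaTrunc_add f g hn
  rw [hconv] at h
  linarith

/-! ### Cauchy for one `n` -/

/-- Cauchy's inequality over the at most `τ(n)` pairs: `S₁(n)² ≤ τ(n) ∑_{lm = n, l > Y} f(l)²g(m)²`.
[folklore] -/
theorem tailFst_sq_le (f g : ℕ → ℝ) (Y n : ℕ) :
    tailFst f g Y n ^ 2 ≤
      (n.divisors.card : ℝ) * ∑ x ∈ n.divisorsAntidiagonal with Y < x.1, f x.1 ^ 2 * g x.2 ^ 2 := by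
  classical
  unfold tailFst
  set s := n.divisorsAntidiagonal.filter fun x => Y < x.1 with hs
  have hcs := sum_mul_sq_le_sq_mul_sq s (fun _ => (1 : ℝ)) (fun x => f x.1 * g x.2)
  simp only [one_mul, one_pow, sum_const, nsmul_eq_mul, mul_one] at hcs
  refine hcs.trans ?_
  have hcard : (s.card : ℝ) ≤ n.divisors.card := by
    have h1 : s.card ≤ n.divisorsAntidiagonal.card := card_filter_le _ _
    rw [← Nat.map_div_right_divisors, card_map] at h1
    exact_mod_cast h1
  refine mul_le_mul hcard (le_of_eq (sum_congr rfl fun x _ => by ring)) ?_ (Nat.cast_nonneg _)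
  exact sum_nonneg fun x _ => by positivity

/-! ### Display (2): summing over `Y < n ≤ Y²` and rearranging into pairs -/

/-- The filtered antidiagonals of `Y < n ≤ Y²` with `l > Y` sit inside the box
`(Y, Y²] × [1, Y]` and are pairwise disjoint: for `F ≥ 0`,
`∑_{Y < n ≤ Y²} ∑_{lm = n, l > Y} F(l, m) ≤ ∑_{Y < l ≤ Y²} ∑_{1 ≤ m ≤ Y} F(l, m)`. [folklore] -/
theorem sum_Ioc_sum_filter_fst_le (F : ℕ × ℕ → ℝ) (hF : ∀ x, 0 ≤ F x) (Y : ℕ) :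
    ∑ n ∈ Ioc Y (Y * Y), ∑ x ∈ n.divisorsAntidiagonal with Y < x.1, F x ≤
      ∑ x ∈ Ioc Y (Y * Y) ×ˢ Icc 1 Y, F x := by
  classical
  set T : ℕ → Finset (ℕ × ℕ) := fun n => n.divisorsAntidiagonal.filter fun x => Y < x.1 with hT
  have hdisj : ((Ioc Y (Y * Y) : Finset ℕ) : Set ℕ).PairwiseDisjoint T := by
    intro n _ m _ hnm
    refine disjoint_left.mpr fun p hp hp' => hnm ?_
    rw [hT, mem_filter, Nat.mem_divisorsAntidiagonal] at hp hp'
    exact hp.1.1.symm.trans hp'.1.1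
  have hsub : (Ioc Y (Y * Y)).biUnion T ⊆ Ioc Y (Y * Y) ×ˢ Icc 1 Y := by
    intro p hp
    rw [mem_biUnion] at hp
    obtain ⟨n, hn, hp⟩ := hp
    rw [hT, mem_filter, Nat.mem_divisorsAntidiagonal] at hp
    rw [mem_Ioc] at hn
    obtain ⟨⟨hpn, hn0⟩, hY⟩ := hp
    have h2 : p.2 ≠ 0 := fun h => hn0 (by rw [← hpn, h, mul_zero])
    have h2' : 1 ≤ p.2 := Nat.pos_of_ne_zero h2
    rw [mem_product, mem_Ioc, mem_Icc]
    refine ⟨⟨hY, ?_⟩, h2', ?_⟩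
    · calc p.1 ≤ p.1 * p.2 := Nat.le_mul_of_pos_right _ h2'
        _ = n := hpn
        _ ≤ Y * Y := hn.2
    · by_contra h
      rw [not_le] at h
      have : Y * Y < p.1 * p.2 := Nat.mul_lt_mul'' hY h
      rw [hpn] at this
      exact absurd (this.trans_le hn.2) (lt_irrefl _)
  calc ∑ n ∈ Ioc Y (Y * Y), ∑ x ∈ n.divisorsAntidiagonal with Y < x.1, F x
      = ∑ x ∈ (Ioc Y (Y * Y)).biUnion T, F x := by rw [sum_biUnion hdisj]
    _ ≤ ∑ x ∈ Ioc Y (Y * Y) ×ˢ Icc 1 Y, F x :=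
        sum_le_sum_of_subset_of_nonneg hsub fun x _ _ => hF x

/-- **Display (2) of ALT-1 §4, first half**:
`∑_{Y < n ≤ Y²} S₁(n)²/n ≤ (∑_{Y < l ≤ Y²} τ(l)f(l)²/l) · (∑_{1 ≤ m ≤ Y} τ(m)g(m)²/m)`.
[folklore] -/
theorem sum_tailFst_sq_div_le (f g : ℕ → ℝ) (Y : ℕ) :
    ∑ n ∈ Ioc Y (Y * Y), tailFst f g Y n ^ 2 / n ≤
      (∑ l ∈ Ioc Y (Y * Y), (l.divisors.card : ℝ) * f l ^ 2 / l) *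
        ∑ m ∈ Icc 1 Y, (m.divisors.card : ℝ) * g m ^ 2 / m := by
  classical
  set F : ℕ × ℕ → ℝ := fun x =>
    ((x.1.divisors.card : ℝ) * f x.1 ^ 2 / x.1) * ((x.2.divisors.card : ℝ) * g x.2 ^ 2 / x.2)
    with hFdef
  have hF : ∀ x, 0 ≤ F x := fun x => by rw [hFdef]; positivity
  -- pointwise: S₁(n)²/n ≤ ∑_{lm = n, l > Y} F(l, m)
  have hpt : ∀ n ∈ Ioc Y (Y * Y),
      tailFst f g Y n ^ 2 / n ≤ ∑ x ∈ n.divisorsAntidiagonal with Y < x.1, F x := by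
    intro n hn
    rw [mem_Ioc] at hn
    have hn0 : (0 : ℝ) < n := by exact_mod_cast (Nat.zero_le Y).trans_lt hn.1
    rw [div_le_iff₀ hn0, sum_mul]
    refine (tailFst_sq_le f g Y n).trans ?_
    rw [mul_sum]
    refine sum_le_sum fun x hx => ?_
    rw [mem_filter, Nat.mem_divisorsAntidiagonal] at hx
    obtain ⟨⟨hxn, hn0'⟩, -⟩ := hx
    have h1 : x.1 ≠ 0 := fun h => hn0' (by rw [← hxn, h, zero_mul])
    have h2 : x.2 ≠ 0 := fun h => hn0' (by rw [← hxn, h, mul_zero])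
    have h1r : (0 : ℝ) < x.1 := by exact_mod_cast Nat.pos_of_ne_zero h1
    have h2r : (0 : ℝ) < x.2 := by exact_mod_cast Nat.pos_of_ne_zero h2
    have hτ : (n.divisors.card : ℝ) ≤ (x.1.divisors.card : ℝ) * x.2.divisors.card := by
      rw [← hxn]
      exact_mod_cast Literature.NumberTheory.Sieve.DFI1995.card_divisors_mul_le x.1 x.2
    have hnx : (n : ℝ) = (x.1 : ℝ) * x.2 := by rw [← hxn]; push_cast; ring
    rw [hFdef]
    simp only
    rw [hnx]
    have : (x.1.divisors.card : ℝ) * f x.1 ^ 2 / x.1 * ((x.2.divisors.card : ℝ) * g x.2 ^ 2 / x.2) *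
        ((x.1 : ℝ) * x.2) = (x.1.divisors.card : ℝ) * x.2.divisors.card * (f x.1 ^ 2 * g x.2 ^ 2) := by
      field_simp
    rw [this]
    have hfg : 0 ≤ f x.1 ^ 2 * g x.2 ^ 2 := by positivity
    nlinarith
  calc ∑ n ∈ Ioc Y (Y * Y), tailFst f g Y n ^ 2 / n
      ≤ ∑ n ∈ Ioc Y (Y * Y), ∑ x ∈ n.divisorsAntidiagonal with Y < x.1, F x := sum_le_sum hpt
    _ ≤ ∑ x ∈ Ioc Y (Y * Y) ×ˢ Icc 1 Y, F x := sum_Ioc_sum_filter_fst_le F hF Y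
    _ = _ := by rw [sum_product, sum_mul_sum]

/-- `S₂` for `(f, g)` is `S₁` for `(g, f)` (swap the divisor pair). [folklore] -/
theorem tailSnd_eq_tailFst_swap (f g : ℕ → ℝ) (Y n : ℕ) :
    tailSnd f g Y n = tailFst g f Y n := by
  classical
  unfold tailSnd tailFst
  refine sum_equiv (Equiv.prodComm ℕ ℕ) (fun x => ?_) (fun x _ => ?_)
  · simp only [mem_filter, Equiv.prodComm_apply, Nat.swap_mem_divisorsAntidiagonal, Prod.fst_swap]
  · simp only [Equiv.prodComm_apply, Prod.fst_swap, Prod.snd_swap]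
    ring

/-- **Display (2) of ALT-1 §4, second half**:
`∑_{Y < n ≤ Y²} S₂(n)²/n ≤ (∑_{Y < m ≤ Y²} τ(m)g(m)²/m) · (∑_{1 ≤ l ≤ Y} τ(l)f(l)²/l)`.
[folklore] -/
theorem sum_tailSnd_sq_div_le (f g : ℕ → ℝ) (Y : ℕ) :
    ∑ n ∈ Ioc Y (Y * Y), tailSnd f g Y n ^ 2 / n ≤
      (∑ m ∈ Ioc Y (Y * Y), (m.divisors.card : ℝ) * g m ^ 2 / m) *
        ∑ l ∈ Icc 1 Y, (l.divisors.card : ℝ) * f l ^ 2 / l := by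
  simp only [tailSnd_eq_tailFst_swap]
  exact sum_tailFst_sq_div_le g f Y

/-! ### Assembly: `E ≤ 2·V_f·U_g + 2·V_g·U_f`, and the source's shape `E ≤ 4·V·U` -/

/-- **ALT-1 §4 (1)–(2) assembled.** If `(f ∗ g)(n) = 0` for all `Y < n ≤ Y²` (in the source:
`ν ∗ υ = δ`), then
`∑_{Y < n ≤ Y²} ς_Y(n)²/n ≤ 2·V_f·U_g + 2·V_g·U_f` with `V_h = ∑_{Y < n ≤ Y²} τ(n)h(n)²/n`,
`U_h = ∑_{1 ≤ n ≤ Y} τ(n)h(n)²/n`. [cite: Zhang2022LandauSiegel, §3, Lemma 3.6 (alternative input)] -/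
theorem sum_sigmaTrunc_sq_div_le (f g : ℕ → ℝ) (Y : ℕ)
    (hconv : ∀ n ∈ Ioc Y (Y * Y), ∑ x ∈ n.divisorsAntidiagonal, f x.1 * g x.2 = 0) :
    ∑ n ∈ Ioc Y (Y * Y), sigmaTrunc f g Y n ^ 2 / n ≤
      2 * ((∑ n ∈ Ioc Y (Y * Y), (n.divisors.card : ℝ) * f n ^ 2 / n) *
            ∑ n ∈ Icc 1 Y, (n.divisors.card : ℝ) * g n ^ 2 / n) +
      2 * ((∑ n ∈ Ioc Y (Y * Y), (n.divisors.card : ℝ) * g n ^ 2 / n) *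
            ∑ n ∈ Icc 1 Y, (n.divisors.card : ℝ) * f n ^ 2 / n) := by
  have hpt : ∀ n ∈ Ioc Y (Y * Y), sigmaTrunc f g Y n ^ 2 / n ≤
      2 * (tailFst f g Y n ^ 2 / n) + 2 * (tailSnd f g Y n ^ 2 / n) := by
    intro n hn
    have hn' := (mem_Ioc.mp hn)
    have hn0 : (0 : ℝ) < n := by exact_mod_cast (Nat.zero_le Y).trans_lt hn'.1
    rw [sigmaTrunc_eq_neg_of_conv_eq_zero f g hn'.2 (hconv n hn)]
    rw [← mul_div_assoc, ← mul_div_assoc, ← add_div, div_le_div_iff_of_pos_right hn0]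
    nlinarith [sq_nonneg (tailFst f g Y n - tailSnd f g Y n)]
  calc ∑ n ∈ Ioc Y (Y * Y), sigmaTrunc f g Y n ^ 2 / n
      ≤ ∑ n ∈ Ioc Y (Y * Y), (2 * (tailFst f g Y n ^ 2 / n) + 2 * (tailSnd f g Y n ^ 2 / n)) :=
        sum_le_sum hpt
    _ = 2 * ∑ n ∈ Ioc Y (Y * Y), tailFst f g Y n ^ 2 / n +
          2 * ∑ n ∈ Ioc Y (Y * Y), tailSnd f g Y n ^ 2 / n := by
        rw [sum_add_distrib, mul_sum, mul_sum]
    _ ≤ _ := by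
        have h1 := sum_tailFst_sq_div_le f g Y
        have h2 := sum_tailSnd_sq_div_le f g Y
        linarith

/-- **The source's shape of the alternative input** (ALT-1 §4, conclusion): if `(f ∗ g)(n) = 0` for
`Y < n ≤ Y²` and `|g| ≤ f ≤ τ` pointwise (in the source `|υ| ≤ ν ≤ τ₂`, by multiplicativity — check
at prime powers), then
`∑_{Y < n ≤ Y²} ς_Y(n)²/n ≤ 4 · (∑_{Y < n ≤ Y²} τ(n)f(n)²/n) · ∑_{1 ≤ n ≤ Y} τ(n)³/n`.
With `f = ν`, `Y = D⁴`: the first factor is a `ζ⁴L⁴`-moment (`≪ 𝓛⁻²⁰¹⁵` under (A) by the source's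
Lemma 3.1 argument and CONVEXITY only), the second is `≍ 𝓛⁸`; total `≪ 𝓛⁻²⁰⁰⁷` = the printed
exponent of Lemma 3.2. [cite: Zhang2022LandauSiegel, §3, Lemma 3.6 (alternative input)] -/
theorem sum_sigmaTrunc_sq_div_le_of_abs_le (f g : ℕ → ℝ) (Y : ℕ)
    (hconv : ∀ n ∈ Ioc Y (Y * Y), ∑ x ∈ n.divisorsAntidiagonal, f x.1 * g x.2 = 0)
    (hgf : ∀ n, |g n| ≤ f n) (hfτ : ∀ n, f n ≤ n.divisors.card) :
    ∑ n ∈ Ioc Y (Y * Y), sigmaTrunc f g Y n ^ 2 / n ≤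
      4 * (∑ n ∈ Ioc Y (Y * Y), (n.divisors.card : ℝ) * f n ^ 2 / n) *
        ∑ n ∈ Icc 1 Y, ((n.divisors.card : ℝ)) ^ 3 / n := by
  have hg2 : ∀ n, g n ^ 2 ≤ f n ^ 2 := fun n => by
    have h := hgf n
    have hf0 : 0 ≤ f n := (abs_nonneg _).trans h
    nlinarith [abs_nonneg (g n), sq_abs (g n)]
  have hf2 : ∀ n, f n ^ 2 ≤ (n.divisors.card : ℝ) ^ 2 := fun n => by
    have hf0 : 0 ≤ f n := (abs_nonneg _).trans (hgf n)
    exact pow_le_pow_left₀ hf0 (hfτ n) 2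
  set V := ∑ n ∈ Ioc Y (Y * Y), (n.divisors.card : ℝ) * f n ^ 2 / n with hV
  set Vg := ∑ n ∈ Ioc Y (Y * Y), (n.divisors.card : ℝ) * g n ^ 2 / n with hVg
  set Uf := ∑ n ∈ Icc 1 Y, (n.divisors.card : ℝ) * f n ^ 2 / n with hUf
  set Ug := ∑ n ∈ Icc 1 Y, (n.divisors.card : ℝ) * g n ^ 2 / n with hUg
  set U := ∑ n ∈ Icc 1 Y, ((n.divisors.card : ℝ)) ^ 3 / n with hU
  have hV0 : 0 ≤ V := sum_nonneg fun n _ => by positivity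
  have hUf0 : 0 ≤ Uf := sum_nonneg fun n _ => by positivity
  have hVgV : Vg ≤ V := sum_le_sum fun n _ => by
    apply div_le_div_of_nonneg_right _ (Nat.cast_nonneg _)
    exact mul_le_mul_of_nonneg_left (hg2 n) (Nat.cast_nonneg _)
  have hUgUf : Ug ≤ Uf := sum_le_sum fun n _ => by
    apply div_le_div_of_nonneg_right _ (Nat.cast_nonneg _)
    exact mul_le_mul_of_nonneg_left (hg2 n) (Nat.cast_nonneg _)
  have hUfU : Uf ≤ U := sum_le_sum fun n _ => by
    apply div_le_div_of_nonneg_right _ (Nat.cast_nonneg _)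
    have : (n.divisors.card : ℝ) * f n ^ 2 ≤ (n.divisors.card : ℝ) * (n.divisors.card : ℝ) ^ 2 :=
      mul_le_mul_of_nonneg_left (hf2 n) (Nat.cast_nonneg _)
    calc (n.divisors.card : ℝ) * f n ^ 2 ≤ (n.divisors.card : ℝ) * (n.divisors.card : ℝ) ^ 2 := this
      _ = (n.divisors.card : ℝ) ^ 3 := by ring
  have hmain := sum_sigmaTrunc_sq_div_le f g Y hconv
  rw [← hV, ← hVg, ← hUf, ← hUg] at hmain
  have h1 : V * Ug ≤ V * U := mul_le_mul_of_nonneg_left (hUgUf.trans hUfU) hV0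
  have h2 : Vg * Uf ≤ V * U := by
    calc Vg * Uf ≤ V * Uf := mul_le_mul_of_nonneg_right hVgV hUf0
      _ ≤ V * U := mul_le_mul_of_nonneg_left hUfU hV0
  linarith


/-! ### The source's instance: `ν = 1 ∗ χ`, `υ = μ ∗ μχ`, `ν ∗ υ = δ` -/

section SourceInstance

open ArithmeticFunction
open scoped ArithmeticFunction.Moebius ArithmeticFunction.zeta

/-- Pointwise multiplication by a COMPLETELY multiplicative `c` distributes over Dirichlet
convolution: `(f ∗ g)·c = (f·c) ∗ (g·c)`. [folklore] -/
theorem pmul_mul_of_map_mul {R : Type*} [CommSemiring R] (f g c : ArithmeticFunction R)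
    (hc : ∀ m n, c (m * n) = c m * c n) :
    (f * g).pmul c = f.pmul c * g.pmul c := by
  ext n
  simp only [pmul_apply, mul_apply, sum_mul]
  refine sum_congr rfl fun x hx => ?_
  rw [Nat.mem_divisorsAntidiagonal] at hx
  rw [← hx.1, hc]
  ring

/-- For a completely multiplicative `c` with `c 1 = 1`: `c ∗ (μ·c) = δ` (the Dirichlet inverse of a
completely multiplicative function is `μ·c`). [folklore] -/
theorem mul_pmul_moebius_eq_one {R : Type*} [CommRing R] (c : ArithmeticFunction R)
    (hc : ∀ m n, c (m * n) = c m * c n) (hc1 : c 1 = 1) :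
    c * (μ : ArithmeticFunction R).pmul c = 1 := by
  have h : c * (μ : ArithmeticFunction R).pmul c =
      ((ζ : ArithmeticFunction R) * (μ : ArithmeticFunction R)).pmul c := by
    rw [pmul_mul_of_map_mul _ _ _ hc, zeta_pmul]
  rw [h, coe_zeta_mul_coe_moebius]
  ext n
  rw [pmul_apply, one_apply]
  split_ifs with hn
  · rw [hn, hc1, mul_one]
  · rw [zero_mul]

/-- The source's `ν = 1 ∗ χ` as an arithmetic function: `ν = ζ ∗ χ`, `∑ ν(n)n⁻ˢ = ζ(s)L(s,χ)`.
[cite: Zhang2022LandauSiegel, §3] -/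
noncomputable def nuOf (χ : ArithmeticFunction ℝ) : ArithmeticFunction ℝ :=
  (ζ : ArithmeticFunction ℝ) * χ

/-- The source's `υ = μ ∗ μχ`: `∑ υ(n)n⁻ˢ = (ζ(s)L(s,χ))⁻¹`. [cite: Zhang2022LandauSiegel, §3] -/
noncomputable def upsilonOf (χ : ArithmeticFunction ℝ) : ArithmeticFunction ℝ :=
  (μ : ArithmeticFunction ℝ) * (μ : ArithmeticFunction ℝ).pmul χ

/-- `ν ∗ υ = (ζ ∗ μ) ∗ (χ ∗ μχ) = δ` for a completely multiplicative `χ` with `χ(1) = 1` (e.g. a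
Dirichlet character restricted to `ℕ`). [cite: Zhang2022LandauSiegel, §3 ("ς(n) = 0 unless n = 1
or D⁴ < n ≤ D⁸")] -/
theorem nuOf_mul_upsilonOf (χ : ArithmeticFunction ℝ) (hχ : ∀ m n, χ (m * n) = χ m * χ n)
    (hχ1 : χ 1 = 1) : nuOf χ * upsilonOf χ = 1 := by
  unfold nuOf upsilonOf
  rw [mul_mul_mul_comm, coe_zeta_mul_coe_moebius, mul_pmul_moebius_eq_one χ hχ hχ1, one_mul]

/-- Hence the hypothesis of `sum_sigmaTrunc_sq_div_le`: `∑_{lm = n} ν(l)υ(m) = 0` for every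
`n ≠ 1`, in particular for `Y < n ≤ Y²` once `Y ≥ 1`. [cite: Zhang2022LandauSiegel, §3] -/
theorem sum_nuOf_mul_upsilonOf_eq_zero (χ : ArithmeticFunction ℝ)
    (hχ : ∀ m n, χ (m * n) = χ m * χ n) (hχ1 : χ 1 = 1) {Y : ℕ} (hY : 1 ≤ Y) :
    ∀ n ∈ Ioc Y (Y * Y), ∑ x ∈ n.divisorsAntidiagonal, nuOf χ x.1 * upsilonOf χ x.2 = 0 := by
  intro n hn
  have hn1 : n ≠ 1 := by have := (mem_Ioc.mp hn).1; omega
  have h := congrArg (fun F : ArithmeticFunction ℝ => F n) (nuOf_mul_upsilonOf χ hχ hχ1)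
  simp only [mul_apply, one_apply, if_neg hn1] at h
  exact h

/-- `ν(n) = ∑_{d ∣ n} χ(d) ≤ τ(n)` when `|χ| ≤ 1`. [cite: Zhang2022LandauSiegel, §3 (ν ≤ τ₂)] -/
theorem nuOf_le_card_divisors (χ : ArithmeticFunction ℝ) (hχ : ∀ n, |χ n| ≤ 1) (n : ℕ) :
    nuOf χ n ≤ n.divisors.card := by
  unfold nuOf
  rw [coe_zeta_mul_apply]
  calc ∑ i ∈ n.divisors, χ i ≤ ∑ _i ∈ n.divisors, (1 : ℝ) :=
        sum_le_sum fun i _ => (le_abs_self _).trans (hχ i)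
    _ = n.divisors.card := by rw [sum_const, nsmul_eq_mul, mul_one]

/-- **A11 for the source's coefficients, general real completely multiplicative `χ` with
`χ(1) = 1`** (`|υ| ≤ ν` is NOT needed in this form): for `Y ≥ 1`,
`∑_{Y < n ≤ Y²} ς(n)²/n ≤ 2·V_ν·U_υ + 2·V_υ·U_ν`, where `V_h = ∑_{Y < n ≤ Y²} τ(n)h(n)²/n` and
`U_h = ∑_{n ≤ Y} τ(n)h(n)²/n`; both `ν²τ₂` and `υ²τ₂` have generating functions with FOUR
`L`-factors (`ν(p)²τ₂(p) = υ(p)²τ₂(p) = 8` at `χ(p) = 1`).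
[cite: Zhang2022LandauSiegel, §3, Lemma 3.6 (alternative input)] -/
theorem sum_sigma_sq_div_le_source (χ : ArithmeticFunction ℝ) (hχ : ∀ m n, χ (m * n) = χ m * χ n)
    (hχ1 : χ 1 = 1) {Y : ℕ} (hY : 1 ≤ Y) :
    ∑ n ∈ Ioc Y (Y * Y), sigmaTrunc (nuOf χ) (upsilonOf χ) Y n ^ 2 / n ≤
      2 * ((∑ n ∈ Ioc Y (Y * Y), (n.divisors.card : ℝ) * nuOf χ n ^ 2 / n) *
            ∑ n ∈ Icc 1 Y, (n.divisors.card : ℝ) * upsilonOf χ n ^ 2 / n) +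
      2 * ((∑ n ∈ Ioc Y (Y * Y), (n.divisors.card : ℝ) * upsilonOf χ n ^ 2 / n) *
            ∑ n ∈ Icc 1 Y, (n.divisors.card : ℝ) * nuOf χ n ^ 2 / n) :=
  sum_sigmaTrunc_sq_div_le _ _ Y (sum_nuOf_mul_upsilonOf_eq_zero χ hχ hχ1 hY)


/-! #### `|υ| ≤ ν ≤ τ` for a real completely multiplicative `χ` with `|χ| ≤ 1` -/

/-- A completely multiplicative `χ` with `χ(1) = 1` is multiplicative. [folklore] -/
theorem isMultiplicative_of_map_mul (χ : ArithmeticFunction ℝ) (hχ : ∀ m n, χ (m * n) = χ m * χ n)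
    (hχ1 : χ 1 = 1) : χ.IsMultiplicative :=
  ⟨hχ1, fun _ => hχ _ _⟩

/-- A completely multiplicative `χ` with `χ(1) = 1` satisfies `χ(pᵏ) = χ(p)ᵏ`. [folklore] -/
theorem map_prime_pow_eq_pow (χ : ArithmeticFunction ℝ) (hχ : ∀ m n, χ (m * n) = χ m * χ n)
    (hχ1 : χ 1 = 1) (p k : ℕ) : χ (p ^ k) = χ p ^ k := by
  induction k with
  | zero => rw [pow_zero, pow_zero, hχ1]
  | succ k ih => rw [pow_succ, hχ, ih, pow_succ]

/-- `ν(pᵏ) = ∑_{i ≤ k} χ(p)ⁱ`. [folklore] -/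
theorem nuOf_apply_prime_pow (χ : ArithmeticFunction ℝ) (hχ : ∀ m n, χ (m * n) = χ m * χ n)
    (hχ1 : χ 1 = 1) {p : ℕ} (hp : p.Prime) (k : ℕ) :
    nuOf χ (p ^ k) = ∑ i ∈ range (k + 1), χ p ^ i := by
  unfold nuOf
  rw [coe_zeta_mul_apply, Nat.sum_divisors_prime_pow hp]
  exact sum_congr rfl fun i _ => map_prime_pow_eq_pow χ hχ hχ1 p i

/-- `(μ·χ)(pʲ) = 1, −χ(p), 0` for `j = 0, 1, ≥ 2`. [folklore] -/
theorem pmul_moebius_apply_prime_pow (χ : ArithmeticFunction ℝ) (hχ1 : χ 1 = 1) {p : ℕ}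
    (hp : p.Prime) (j : ℕ) :
    (μ : ArithmeticFunction ℝ).pmul χ (p ^ j) =
      if j = 0 then 1 else if j = 1 then -χ p else 0 := by
  rw [pmul_apply, intCoe_apply]
  rcases j with _ | _ | j
  · simp [hχ1]
  · simp [ArithmeticFunction.moebius_apply_prime hp]
  · rw [ArithmeticFunction.moebius_apply_prime_pow hp (by omega)]
    simp

/-- `υ(pᵏ) = (μ·χ)(pᵏ) − (μ·χ)(pᵏ⁻¹)` for `k ≥ 1`, i.e. `υ(p) = −1 − χ(p)`, `υ(p²) = χ(p)`,
`υ(pᵏ) = 0` for `k ≥ 3`. [folklore] -/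
theorem upsilonOf_apply_prime_pow (χ : ArithmeticFunction ℝ) (hχ1 : χ 1 = 1) {p : ℕ}
    (hp : p.Prime) {k : ℕ} (hk : 0 < k) :
    upsilonOf χ (p ^ k) = if k = 1 then -1 - χ p else if k = 2 then χ p else 0 := by
  unfold upsilonOf
  set g : ArithmeticFunction ℝ := (μ : ArithmeticFunction ℝ).pmul χ with hg
  have hgval : ∀ j, g (p ^ j) = if j = 0 then 1 else if j = 1 then -χ p else 0 :=
    fun j => by rw [hg]; exact pmul_moebius_apply_prime_pow χ hχ1 hp j
  rw [mul_apply,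
    Nat.sum_divisorsAntidiagonal (fun a b => ((μ : ArithmeticFunction ℝ) a) * g b),
    Nat.sum_divisors_prime_pow hp]
  obtain ⟨k', rfl⟩ : ∃ k', k = k' + 1 := ⟨k - 1, by omega⟩
  rw [sum_range_succ', sum_range_succ']
  have hrest : ∑ i ∈ range k', ((μ : ArithmeticFunction ℝ) (p ^ (i + 1 + 1))) *
      g (p ^ (k' + 1) / p ^ (i + 1 + 1)) = 0 := by
    refine sum_eq_zero fun i _ => ?_
    rw [intCoe_apply, ArithmeticFunction.moebius_apply_prime_pow hp (by omega)]
    simp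
  rw [hrest, zero_add, pow_zero, Nat.div_one, pow_one, intCoe_apply, intCoe_apply,
    ArithmeticFunction.moebius_apply_prime hp, ArithmeticFunction.moebius_apply_one,
    show p ^ (k' + 1) / p = p ^ k' from by rw [pow_succ, Nat.mul_div_cancel _ hp.pos],
    hgval, hgval]
  rcases k' with _ | _ | k'
  · simp; ring
  · simp
  · have h4 : k' + 1 + 1 + 1 ≠ 2 := by omega
    simp [h4]

/-- At prime powers `|υ(pᵏ)| ≤ ν(pᵏ)` when `−1 ≤ χ(p) ≤ 1` (the three cases `k = 1, 2, ≥ 3`).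
[folklore] -/
theorem abs_upsilonOf_le_nuOf_prime_pow (χ : ArithmeticFunction ℝ)
    (hχ : ∀ m n, χ (m * n) = χ m * χ n) (hχ1 : χ 1 = 1) (hχabs : ∀ n, |χ n| ≤ 1) {p : ℕ}
    (hp : p.Prime) {k : ℕ} (hk : 0 < k) :
    |upsilonOf χ (p ^ k)| ≤ nuOf χ (p ^ k) := by
  have hx := abs_le.mp (hχabs p)
  rw [upsilonOf_apply_prime_pow χ hχ1 hp hk, nuOf_apply_prime_pow χ hχ hχ1 hp]
  rcases Nat.lt_or_ge k 3 with h | h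
  · interval_cases k
    · simp only [if_true, sum_range_succ, sum_range_zero, pow_zero, pow_one, zero_add]
      rw [abs_le]; constructor <;> linarith
    · simp only [show (2:ℕ) ≠ 1 from by decide, if_false, if_true, sum_range_succ, sum_range_zero,
        pow_zero, pow_one, zero_add]
      rw [abs_le]; constructor <;> nlinarith [sq_nonneg (χ p), sq_nonneg (χ p + 1)]
  · rw [if_neg (by omega), if_neg (by omega), abs_zero]
    rcases eq_or_lt_of_le hx.1 with he | hlt
    · rw [← he, neg_one_geom_sum]
      split_ifs <;> norm_num
    · exact (geom_sum_pos' (by linarith) (by omega)).le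

/-- Comparison of multiplicative functions from prime powers: if `f, g` are multiplicative and
`|f(pᵏ)| ≤ g(pᵏ)` at every prime power then `|f(n)| ≤ g(n)` for all `n ≥ 1`. [folklore] -/
theorem abs_le_of_isMultiplicative {f g : ArithmeticFunction ℝ} (hf : f.IsMultiplicative)
    (hg : g.IsMultiplicative) (h : ∀ p k : ℕ, p.Prime → 0 < k → |f (p ^ k)| ≤ g (p ^ k)) :
    ∀ n, n ≠ 0 → |f n| ≤ g n := by
  intro n
  induction n using Nat.recOnPosPrimePosCoprime with
  | zero => intro h0; exact absurd rfl h0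
  | one => intro; rw [hf.map_one, hg.map_one, abs_one]
  | prime_pow p k hp hk => intro; exact h p k hp hk
  | coprime a b ha hb hab iha ihb =>
    intro
    have ha' := iha (by omega)
    have hb' := ihb (by omega)
    rw [hf.map_mul_of_coprime hab, hg.map_mul_of_coprime hab, abs_mul]
    exact mul_le_mul ha' hb' (abs_nonneg _) ((abs_nonneg _).trans ha')

/-- `|υ(n)| ≤ ν(n)` for all `n`, for a real completely multiplicative `χ` with `χ(1) = 1`,
`|χ| ≤ 1` (e.g. a real Dirichlet character on `ℕ`). [cite: Zhang2022LandauSiegel, §3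
("|ς(n)| ≤ ∑ ν(l)|υ(m)|")] -/
theorem abs_upsilonOf_le_nuOf (χ : ArithmeticFunction ℝ) (hχ : ∀ m n, χ (m * n) = χ m * χ n)
    (hχ1 : χ 1 = 1) (hχabs : ∀ n, |χ n| ≤ 1) (n : ℕ) : |upsilonOf χ n| ≤ nuOf χ n := by
  rcases eq_or_ne n 0 with rfl | hn
  · simp
  have hχm := isMultiplicative_of_map_mul χ hχ hχ1
  have hν : (nuOf χ).IsMultiplicative := isMultiplicative_zeta.natCast.mul hχm
  have hυ : (upsilonOf χ).IsMultiplicative :=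
    isMultiplicative_moebius.intCast.mul (isMultiplicative_moebius.intCast.pmul hχm)
  exact abs_le_of_isMultiplicative hυ hν
    (fun p k hp hk => abs_upsilonOf_le_nuOf_prime_pow χ hχ hχ1 hχabs hp hk) n hn

/-- **A11 in the source's shape, for the source's coefficients.** For a real completely
multiplicative `χ` with `χ(1) = 1`, `|χ| ≤ 1` (a real Dirichlet character on `ℕ`), `ν = 1 ∗ χ`,
`υ = μ ∗ μχ`, `ς(n) = ∑_{lm = n, l, m ≤ Y} ν(l)υ(m)` and `Y ≥ 1`:
`∑_{Y < n ≤ Y²} ς(n)²/n ≤ 4 · (∑_{Y < n ≤ Y²} τ(n)ν(n)²/n) · ∑_{n ≤ Y} τ(n)³/n`.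
With `Y = D⁴` this replaces the source's route `|ς| ≤ ντ₂` + Lemma 3.2 (`ζ⁸L⁸`, subconvexity)
by a `ζ⁴L⁴`-moment (convexity) times `𝓛⁸`, same final exponent `2007`.
[cite: Zhang2022LandauSiegel, §3, Lemma 3.6 (alternative input)] -/
theorem sum_sigma_sq_div_le_source_tau_cubed (χ : ArithmeticFunction ℝ)
    (hχ : ∀ m n, χ (m * n) = χ m * χ n) (hχ1 : χ 1 = 1) (hχabs : ∀ n, |χ n| ≤ 1) {Y : ℕ}
    (hY : 1 ≤ Y) :
    ∑ n ∈ Ioc Y (Y * Y), sigmaTrunc (nuOf χ) (upsilonOf χ) Y n ^ 2 / n ≤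
      4 * (∑ n ∈ Ioc Y (Y * Y), (n.divisors.card : ℝ) * nuOf χ n ^ 2 / n) *
        ∑ n ∈ Icc 1 Y, ((n.divisors.card : ℝ)) ^ 3 / n :=
  sum_sigmaTrunc_sq_div_le_of_abs_le _ _ Y (sum_nuOf_mul_upsilonOf_eq_zero χ hχ hχ1 hY)
    (abs_upsilonOf_le_nuOf χ hχ hχ1 hχabs) (nuOf_le_card_divisors χ hχabs)

end SourceInstance

/-! ### The divisor factor made explicit: `∑_{n ≤ Y} τ(n)³/n ≤ (1 + log Y)⁸`

The second factor `U = ∑_{n ≤ Y} τ(n)³/n` of `sum_sigmaTrunc_sq_div_le_of_abs_le` (the cell's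
parameter `mTau3 = 8`, "`U ≍ 𝓛⁸`") is bounded in CLOSED FORM, with constant `1`, by iterated Cauchy
products: writing `τ(n)^{j+1}/n = ∑_{lm = n} τ(lm)^j/(lm)`, using `τ(lm) ≤ τ(l)τ(m)` and passing to
the box `[1, Y]²` gives `∑_{n ≤ Y} τ(n)^{j+1}/n ≤ (∑_{n ≤ Y} τ(n)^j/n)²`, hence with
`∑_{n ≤ Y} 1/n ≤ 1 + log Y`: `∑_{n ≤ Y} τ(n)^j/n ≤ (1 + log Y)^{2^j}` and `U ≤ (1 + log Y)⁸`.
(Local copies — so that this module keeps importing only Mathlib and the DFI divisor lemma — of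
`ZetaM4D.sum_card_divisors_pow_succ_div_le` / `ZetaM4D.sum_card_divisors_pow_div_le` of
`Literature/NumberTheory/LFunctions/HuxleyLargeValuesFourthMomentProofs.lean`.) Consequently A11
reads, fully explicitly in its elementary part,
`∑_{Y < n ≤ Y²} ς(n)²/n ≤ 4 (1 + log Y)⁸ · ∑_{Y < n ≤ Y²} τ(n)ν(n)²/n`
(`sum_sigma_sq_div_le_source_log_pow`; with `Y = D⁴`: `4 (1 + 4 log D)⁸ · V_ν`), leaving the
`ζ⁴L⁴`-moment `V_ν` as the ONLY analytic quantity of the alternative route.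
-/

section DivisorFactor

/-- **Iterated Cauchy product**: `∑_{1 ≤ n ≤ Y} τ(n)^{j+1}/n ≤ (∑_{1 ≤ n ≤ Y} τ(n)^j/n)²`.
[folklore] -/
theorem sum_card_divisors_pow_succ_div_le_sq (j Y : ℕ) :
    ∑ n ∈ Icc 1 Y, (n.divisors.card : ℝ) ^ (j + 1) / n ≤
      (∑ n ∈ Icc 1 Y, (n.divisors.card : ℝ) ^ j / n) ^ 2 := by
  classical
  -- the antidiagonal of `n` has `τ(n)` elements (the tree's
  -- `GaussianHecke.card_divisorsAntidiagonal_eq`, inlined to keep the imports minimal)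
  have hcard : ∀ n : ℕ, n.divisorsAntidiagonal.card = n.divisors.card := fun n => by
    rw [← Nat.map_div_right_divisors, Finset.card_map]
  -- `τ(n)^{j+1}/n = ∑_{lm = n} τ(lm)^j/(lm)`
  have h1 : ∀ n ∈ Icc 1 Y, (n.divisors.card : ℝ) ^ (j + 1) / n =
      ∑ p ∈ n.divisorsAntidiagonal, ((p.1 * p.2).divisors.card : ℝ) ^ j / (p.1 * p.2 : ℕ) := by
    intro n _
    have hconst : ∀ p ∈ n.divisorsAntidiagonal,
        ((p.1 * p.2).divisors.card : ℝ) ^ j / (p.1 * p.2 : ℕ) = (n.divisors.card : ℝ) ^ j / n := by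
      intro p hp
      rw [(Nat.mem_divisorsAntidiagonal.mp hp).1]
    rw [sum_congr rfl hconst, sum_const, hcard, nsmul_eq_mul, pow_succ]
    ring
  rw [sum_congr rfl h1]
  -- `τ(lm) ≤ τ(l)τ(m)` termwise
  have h2 : ∀ n ∈ Icc 1 Y, ∑ p ∈ n.divisorsAntidiagonal,
      ((p.1 * p.2).divisors.card : ℝ) ^ j / (p.1 * p.2 : ℕ) ≤
      ∑ p ∈ n.divisorsAntidiagonal,
        (p.1.divisors.card : ℝ) ^ j / p.1 * ((p.2.divisors.card : ℝ) ^ j / p.2) := by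
    intro n _
    refine sum_le_sum fun p hp => ?_
    have hd : ((p.1 * p.2).divisors.card : ℝ) ^ j ≤
        (p.1.divisors.card : ℝ) ^ j * (p.2.divisors.card : ℝ) ^ j := by
      rw [← mul_pow]
      exact pow_le_pow_left₀ (by positivity)
        (by exact_mod_cast Literature.NumberTheory.Sieve.DFI1995.card_divisors_mul_le p.1 p.2) j
    rw [div_mul_div_comm]
    push_cast
    exact div_le_div_of_nonneg_right hd (by positivity)
  refine (sum_le_sum h2).trans ?_
  -- the antidiagonals of `1 ≤ n ≤ Y` are disjoint and sit inside the box `[1, Y]²`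
  rw [← sum_biUnion]
  · rw [sq, sum_mul_sum, ← sum_product']
    refine sum_le_sum_of_subset_of_nonneg ?_ fun p _ _ => by positivity
    intro p hp
    obtain ⟨n, hn, hpn⟩ := mem_biUnion.mp hp
    have hp12 : p.1 * p.2 = n := (Nat.mem_divisorsAntidiagonal.mp hpn).1
    have hn0 : n ≠ 0 := (Nat.mem_divisorsAntidiagonal.mp hpn).2
    have hnY : n ≤ Y := (mem_Icc.mp hn).2
    have hp1 : 0 < p.1 := Nat.pos_of_ne_zero fun h => hn0 (by rw [← hp12, h, zero_mul])
    have hp2 : 0 < p.2 := Nat.pos_of_ne_zero fun h => hn0 (by rw [← hp12, h, mul_zero])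
    refine mem_product.mpr ⟨mem_Icc.mpr ⟨hp1, ?_⟩, mem_Icc.mpr ⟨hp2, ?_⟩⟩
    · calc p.1 ≤ p.1 * p.2 := Nat.le_mul_of_pos_right _ hp2
        _ ≤ Y := hp12 ▸ hnY
    · calc p.2 ≤ p.1 * p.2 := Nat.le_mul_of_pos_left _ hp1
        _ ≤ Y := hp12 ▸ hnY
  · intro n _ n' _ hne
    rw [Function.onFun, disjoint_left]
    intro p hp hp'
    exact hne ((Nat.mem_divisorsAntidiagonal.mp hp).1.symm.trans
      (Nat.mem_divisorsAntidiagonal.mp hp').1)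

/-- The harmonic bound in this module's shape: `∑_{1 ≤ n ≤ Y} 1/n ≤ 1 + log Y` (Mathlib's
`harmonic_le_one_add_log`). [folklore] -/
theorem sum_Icc_one_div_le_one_add_log (Y : ℕ) :
    ∑ n ∈ Icc 1 Y, (1 : ℝ) / n ≤ 1 + Real.log Y := by
  have h := harmonic_le_one_add_log Y
  rw [harmonic_eq_sum_Icc] at h
  push_cast at h
  simpa [one_div] using h

/-- **Divisor power moments**: `∑_{1 ≤ n ≤ Y} τ(n)^j/n ≤ (1 + log Y)^{2^j}` for every `j`.
[folklore] -/
theorem sum_card_divisors_pow_div_le_log_pow (j Y : ℕ) :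
    ∑ n ∈ Icc 1 Y, (n.divisors.card : ℝ) ^ j / n ≤ (1 + Real.log Y) ^ (2 ^ j) := by
  induction j with
  | zero => simpa using sum_Icc_one_div_le_one_add_log Y
  | succ j ih =>
    calc ∑ n ∈ Icc 1 Y, (n.divisors.card : ℝ) ^ (j + 1) / n
        ≤ (∑ n ∈ Icc 1 Y, (n.divisors.card : ℝ) ^ j / n) ^ 2 :=
          sum_card_divisors_pow_succ_div_le_sq j Y
      _ ≤ ((1 + Real.log Y) ^ (2 ^ j)) ^ 2 :=
          pow_le_pow_left₀ (sum_nonneg fun n _ => by positivity) ih 2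
      _ = (1 + Real.log Y) ^ (2 ^ (j + 1)) := by rw [← pow_mul, pow_succ]

/-- **The divisor factor of A11**: `U = ∑_{1 ≤ n ≤ Y} τ(n)³/n ≤ (1 + log Y)⁸` — the cell's
`mTau3 = 8` with constant `1`. [folklore] -/
theorem sum_card_divisors_cube_div_le_log_pow (Y : ℕ) :
    ∑ n ∈ Icc 1 Y, (n.divisors.card : ℝ) ^ 3 / n ≤ (1 + Real.log Y) ^ 8 := by
  simpa using sum_card_divisors_pow_div_le_log_pow 3 Y

/-- **A11, general form, with the divisor factor explicit.** If `(f ∗ g)(n) = 0` for `Y < n ≤ Y²`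
and `|g| ≤ f ≤ τ` pointwise, then
`∑_{Y < n ≤ Y²} ς_Y(n)²/n ≤ 4 (1 + log Y)⁸ · ∑_{Y < n ≤ Y²} τ(n)f(n)²/n`.
[cite: Zhang2022LandauSiegel, §3, Lemma 3.6 (alternative input)] -/
theorem sum_sigmaTrunc_sq_div_le_log_pow (f g : ℕ → ℝ) (Y : ℕ)
    (hconv : ∀ n ∈ Ioc Y (Y * Y), ∑ x ∈ n.divisorsAntidiagonal, f x.1 * g x.2 = 0)
    (hgf : ∀ n, |g n| ≤ f n) (hfτ : ∀ n, f n ≤ n.divisors.card) :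
    ∑ n ∈ Ioc Y (Y * Y), sigmaTrunc f g Y n ^ 2 / n ≤
      4 * (1 + Real.log Y) ^ 8 * ∑ n ∈ Ioc Y (Y * Y), (n.divisors.card : ℝ) * f n ^ 2 / n := by
  have hV0 : 0 ≤ ∑ n ∈ Ioc Y (Y * Y), (n.divisors.card : ℝ) * f n ^ 2 / n :=
    sum_nonneg fun n _ => by positivity
  calc ∑ n ∈ Ioc Y (Y * Y), sigmaTrunc f g Y n ^ 2 / n
      ≤ 4 * (∑ n ∈ Ioc Y (Y * Y), (n.divisors.card : ℝ) * f n ^ 2 / n) *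
          ∑ n ∈ Icc 1 Y, ((n.divisors.card : ℝ)) ^ 3 / n :=
        sum_sigmaTrunc_sq_div_le_of_abs_le f g Y hconv hgf hfτ
    _ ≤ 4 * (∑ n ∈ Ioc Y (Y * Y), (n.divisors.card : ℝ) * f n ^ 2 / n) * (1 + Real.log Y) ^ 8 :=
        mul_le_mul_of_nonneg_left (sum_card_divisors_cube_div_le_log_pow Y) (by positivity)
    _ = 4 * (1 + Real.log Y) ^ 8 * ∑ n ∈ Ioc Y (Y * Y), (n.divisors.card : ℝ) * f n ^ 2 / n := by
        ring

open ArithmeticFunction in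
/-- **A11 for the source's coefficients, with the divisor factor explicit.** For a real completely
multiplicative `χ` with `χ(1) = 1`, `|χ| ≤ 1` (a real Dirichlet character on `ℕ`), `ν = 1 ∗ χ`,
`υ = μ ∗ μχ`, `ς(n) = ∑_{lm = n, l, m ≤ Y} ν(l)υ(m)`, `Y ≥ 1`:
`∑_{Y < n ≤ Y²} ς(n)²/n ≤ 4 (1 + log Y)⁸ · ∑_{Y < n ≤ Y²} τ(n)ν(n)²/n`.
With `Y = D⁴`: `E ≤ 4 (1 + 4 log D)⁸ · V_ν`, `V_ν` a `ζ⁴L⁴`-moment over `(D⁴, D⁸]` — the only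
analytic quantity left in the alternative input for Lemma 3.6 (`V_ν ≪ 𝓛⁻²⁰¹⁵` under (A) by a
contour shift inside the convexity range, NOT formalised; total `≪ 𝓛⁻²⁰⁰⁷`).
[cite: Zhang2022LandauSiegel, §3, Lemma 3.6 (alternative input)] -/
theorem sum_sigma_sq_div_le_source_log_pow (χ : ArithmeticFunction ℝ)
    (hχ : ∀ m n, χ (m * n) = χ m * χ n) (hχ1 : χ 1 = 1) (hχabs : ∀ n, |χ n| ≤ 1) {Y : ℕ}
    (hY : 1 ≤ Y) :
    ∑ n ∈ Ioc Y (Y * Y), sigmaTrunc (nuOf χ) (upsilonOf χ) Y n ^ 2 / n ≤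
      4 * (1 + Real.log Y) ^ 8 *
        ∑ n ∈ Ioc Y (Y * Y), (n.divisors.card : ℝ) * nuOf χ n ^ 2 / n :=
  sum_sigmaTrunc_sq_div_le_log_pow _ _ Y (sum_nuOf_mul_upsilonOf_eq_zero χ hχ hχ1 hY)
    (abs_upsilonOf_le_nuOf χ hχ hχ1 hχabs) (nuOf_le_card_divisors χ hχabs)

end DivisorFactor

end Literature.NumberTheory.LFunctions.Zhang2022
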